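import Summits.BirchSwinnertonDyer.BirchSwinnertonDyer.Theorems.PrintX10bBeyondCarrierV62Witnesses
import Literature.NumberTheory.EllipticCurves.IwasawaAlgebraSpecializationIndexProofs
import HarnessLib

/-!
# Crux `BeyondCarrierDepthX10b` (stmt-BirchSwinnertonDyer-23055, PrintX10b aside r301), line «twins», skeleton
# v6.2: the μ-part stub s2c BY SIGNATURE from a SPECIALISED INDEX INEQUALITY, uniform in `m`
# (Howard's primes `q_m = T^m + 3`) — the algebraic half (E) of idea `specialise-first-mu-x10b` in the kernel

HONEST FRAMING (cell `run/shared/lean/pub/bsd-print-x9/`, LEAD seat bsd-line-x10b-p1 g3, D-0154 KEY row 10): THEOREMS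
ONLY, helper `--supports 23055`; nothing booked, nothing closed. The hypothesis `hKS` below is an ARITHMETIC statement
(the specialised Kolyvagin-system bound at Howard's Eisenstein primes `q_m`, uniform in `m`, on the `3 ∣ h_K` X10b
frames) which is NOT in print at `p = 3`, `3 ∣ h_K`, non-surjective irreducible image (REF-118; lit DOSSIER §57: zero
printed theorems for X10b) — this file does not claim it. «beyond-print theorem»: NO. BSD is not proved by any of this;
no summit statement is proved by this seat.

WHAT. `stub_muPart_divisibleClassNumber_of_card_quotSMulTop_qm_le (hKS)` — the registered stub s2c
(`Stmt.muPartDivisible`, skeleton `Cruxes/BeyondCarrierDepthX10b/Lines/twins.lean`) VERBATIM, from: on every rank-one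
`3 ∣ h_K` X10b Heegner frame, for every `(D, F, X)` with `F.Dt = Dt`, `𝔖`, `X.X` finitely generated and `𝔖/ℋ_F`
torsion, THERE ARE `C, m₀` WITH `#(X_tors ⧸ q_m X_tors) ≤ p^C · #((𝔖/ℋ_F) ⧸ q_m (𝔖/ℋ_F))²` FOR ALL `m ≥ m₀`
(`q_m = X^m + p ∈ Λ`). Proof: the Literature theorem
`IwasawaAlgebra.lengthAt_le_two_mul_of_card_quotSMulTop_qm_le` (this seat: specialised-index asymptotics
`#(N ⧸ q_m N) ≍ p^{m μ(N)}` for f.g. torsion `Λ`-modules via the structure theorem, the exact count on elementary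
modules and seat x10b-p1-w2's index comparison under pseudo-isomorphisms) turns `hKS` into the μ-INEQUALITY
`length_(p)(X_tors) ≤ 2 · length_(p)(𝔖/ℋ_F)`, and `stub_muPart_divisibleClassNumber_of_muInvariant_le` (g2, p617207)
turns that into s2c. So the crux's one open statement is now, in the kernel, EITHER the μ-inequality OR its
specialised form `hKS` — the shape in which Howard's proof of Thm. 2.2.10 delivers it (the remaining arithmetic:
MZ26 Thm. 2.40 at the DVRs `Λ/q_m = ℤ_3[π]` + finite-decomposition error terms, card §(K_m), definition
requests D1/D2 pending).

References: [Howard2004HeegnerKolyvagin] proof of Thm. 2.2.10 (arXiv:1202.6340 p. 18, «taking 𝔮 = T^m + p»);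
[MazurRubin2004] §5.3; [Washington1997] §13.2; skeleton v6.2 `Cruxes/BeyondCarrierDepthX10b/Lines/twins.lean`;
idea card `Cruxes/HowardContainmentAnyClassNumberX10b/Ideas/specialise-first-mu-x10b.md`.
-/

-- the REGISTERED stub namespace `Summit.BirchSwinnertonDyer.BirchSwinnertonDyer.Cruxes.…` repeats the summit name
set_option linter.dupNamespace false
set_option autoImplicit false

noncomputable section

open scoped Classical

open WeierstrassCurve NumberField Field Literature.NumberTheory.EllipticCurves
  Literature.NumberTheory.EllipticCurves.ModularForms Literature.NumberTheory.EllipticCurves.Rank1Residual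
  Literature.NumberTheory.EllipticCurves.CastellaGrossiLeeSkinner2022

namespace Summit.BirchSwinnertonDyer.BirchSwinnertonDyer.Cruxes.BeyondCarrierDepthX10b.HowardFrames

/-- **v6.2 stub s2c (the μ-part) BY SIGNATURE from the SPECIALISED INDEX INEQUALITY at Howard's primes
`q_m = X^m + p`, uniform in `m`**: if on every rank-one `3 ∣ h_K` X10b Heegner frame, for every `Λ`-adic Selmer
datum `D`, Heegner family `F` tied to the frame (`F.Dt = Dt`) and Selmer dual `X` with `𝔖`, `X.X` finitely generated
and `𝔖/ℋ_F` torsion, there are `C, m₀` with `#(X_tors ⧸ q_m X_tors) ≤ p^C · #((𝔖/ℋ_F) ⧸ q_m)²` for all `m ≥ m₀`,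
then s2c holds. Chain: `hKS` ⟹ (`IwasawaAlgebra.lengthAt_le_two_mul_of_card_quotSMulTop_qm_le`) the μ-inequality
`μ(X_tors) ≤ 2 μ(𝔖/ℋ_F)` ⟹ (`stub_muPart_divisibleClassNumber_of_muInvariant_le`, p617207) s2c. NOT in print at
`p = 3`, `3 ∣ h_K`, (irr) ¬Surj; `hKS` is where Howard's proof of Thm. 2.2.10 would deliver it.
[cite: Howard2004HeegnerKolyvagin, proof of Thm. 2.2.10 (𝔮 = T^m + p)] [cite: PerrinRiou1987BSMF, §1 Conj. B]
[cite: Washington1997, §13.2] -/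
theorem stub_muPart_divisibleClassNumber_of_card_quotSMulTop_qm_le
    (hKS : ∀ (W : WeierstrassCurve ℚ) [W.IsElliptic] [W.IsGloballyMinimal] (p : ℕ) [Fact p.Prime]
      [NeZero (W.conductorNorm ℤ)] (K : Type) [Field K] [NumberField K],
      Literature.NumberTheory.EllipticCurves.Rank1Residual.ClassX10 W p →
      ¬ Literature.NumberTheory.EllipticCurves.Rank1Residual.Surj W 3 → ¬ W.HasCM →
      Literature.NumberTheory.EllipticCurves.IsImaginaryQuadratic K → Odd (NumberField.discr K) →
      NumberField.discr K ≠ -3 →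
      Literature.NumberTheory.EllipticCurves.SatisfiesHeegnerHypothesis (W.conductorNorm ℤ) K →
      Literature.NumberTheory.EllipticCurves.SatisfiesHeegnerHypothesis p K →
      p ∣ NumberField.classNumber K →
      (W.baseChange K).HasIrreducibleModPGaloisRep p →
      ∀ (κ : Literature.NumberTheory.EllipticCurves.ZpExtension K p), κ.IsAnticyclotomic →
      ∀ (γ : Field.absoluteGaloisGroup K), κ.IsTopGenerator γ →
      ∀ (Dt : Literature.NumberTheory.EllipticCurves.ModularForms.ModularParametrizationData W
        (W.conductorNorm ℤ)) (jbar : AlgebraicClosure K →+* ℂ),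
      ¬ (p : ℤ) ∣ Dt.c → (W.baseChange K).mordellWeilRank = 1 →
      Finite (AddCommGroup.primaryComponent (W.baseChange K).sha p) →
      ∀ (D : (W.baseChange K).LambdaAdicSelmerData κ γ)
        (F : Literature.NumberTheory.EllipticCurves.HeegnerFamily (W.conductorNorm ℤ) W K κ jbar)
        (X : (W.baseChange K).SelmerDualData κ γ), F.Dt = Dt →
        Module.Finite (Literature.NumberTheory.EllipticCurves.IwasawaAlgebra p) D.S →
        Module.Finite (Literature.NumberTheory.EllipticCurves.IwasawaAlgebra p) X.X →
        Module.IsTorsion (Literature.NumberTheory.EllipticCurves.IwasawaAlgebra p)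
          (D.S ⧸ Literature.NumberTheory.EllipticCurves.heegnerModule D F) →
      ∃ C m₀ : ℕ, ∀ m : ℕ, m₀ ≤ m →
        Nat.card (↥(Submodule.torsion (Literature.NumberTheory.EllipticCurves.IwasawaAlgebra p) X.X) ⧸
          (Ideal.span {(PowerSeries.X ^ m + PowerSeries.C (p : ℤ_[p]) :
              Literature.NumberTheory.EllipticCurves.IwasawaAlgebra p)} • ⊤ :
            Submodule (Literature.NumberTheory.EllipticCurves.IwasawaAlgebra p)
              ↥(Submodule.torsion (Literature.NumberTheory.EllipticCurves.IwasawaAlgebra p) X.X))) ≤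
        p ^ C * Nat.card ((D.S ⧸ Literature.NumberTheory.EllipticCurves.heegnerModule D F) ⧸
          (Ideal.span {(PowerSeries.X ^ m + PowerSeries.C (p : ℤ_[p]) :
              Literature.NumberTheory.EllipticCurves.IwasawaAlgebra p)} • ⊤ :
            Submodule (Literature.NumberTheory.EllipticCurves.IwasawaAlgebra p)
              (D.S ⧸ Literature.NumberTheory.EllipticCurves.heegnerModule D F))) ^ 2) :
    ∀ (W : WeierstrassCurve ℚ) [W.IsElliptic] [W.IsGloballyMinimal] (p : ℕ) [Fact p.Prime]
    [NeZero (W.conductorNorm ℤ)] (K : Type) [Field K] [NumberField K],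
    Literature.NumberTheory.EllipticCurves.Rank1Residual.ClassX10 W p →
    ¬ Literature.NumberTheory.EllipticCurves.Rank1Residual.Surj W 3 → ¬ W.HasCM →
    Literature.NumberTheory.EllipticCurves.IsImaginaryQuadratic K → Odd (NumberField.discr K) →
    NumberField.discr K ≠ -3 →
    Literature.NumberTheory.EllipticCurves.SatisfiesHeegnerHypothesis (W.conductorNorm ℤ) K →
    Literature.NumberTheory.EllipticCurves.SatisfiesHeegnerHypothesis p K →
    p ∣ NumberField.classNumber K →
    (W.baseChange K).HasIrreducibleModPGaloisRep p →
    ∀ (κ : Literature.NumberTheory.EllipticCurves.ZpExtension K p), κ.IsAnticyclotomic →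
    ∀ (γ : Field.absoluteGaloisGroup K), κ.IsTopGenerator γ →
    ∀ (Dt : Literature.NumberTheory.EllipticCurves.ModularForms.ModularParametrizationData W
      (W.conductorNorm ℤ))
      (H : Literature.NumberTheory.EllipticCurves.HeegnerDatum (W.conductorNorm ℤ) (NumberField.discr K))
      (ιC : K →+* ℂ) (jbar : AlgebraicClosure K →+* ℂ),
    ¬ (p : ℤ) ∣ Dt.c → (W.baseChange K).mordellWeilRank = 1 →
    Finite (AddCommGroup.primaryComponent (W.baseChange K).sha p) →
    (∃ (D : (W.baseChange K).LambdaAdicSelmerData κ γ)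
        (F : Literature.NumberTheory.EllipticCurves.HeegnerFamily (W.conductorNorm ℤ) W K κ jbar)
        (X : (W.baseChange K).SelmerDualData κ γ) (m : ℕ),
        F.Dt = Dt ∧ Module.Finite (Literature.NumberTheory.EllipticCurves.IwasawaAlgebra p) D.S ∧
        Module.Finite (Literature.NumberTheory.EllipticCurves.IwasawaAlgebra p) X.X ∧
        Module.IsTorsion (Literature.NumberTheory.EllipticCurves.IwasawaAlgebra p)
          (D.S ⧸ Literature.NumberTheory.EllipticCurves.heegnerModule D F) ∧
        Ideal.span {((p : Literature.NumberTheory.EllipticCurves.IwasawaAlgebra p) ^ m)} *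
            Literature.NumberTheory.EllipticCurves.heegnerCharIdeal D F ^ 2 ≤
          Literature.NumberTheory.EllipticCurves.Module.charIdeal
            (Literature.NumberTheory.EllipticCurves.IwasawaAlgebra p)
            (Submodule.torsion (Literature.NumberTheory.EllipticCurves.IwasawaAlgebra p) X.X)) →
    ∃ (D : (W.baseChange K).LambdaAdicSelmerData κ γ)
      (F : Literature.NumberTheory.EllipticCurves.HeegnerFamily (W.conductorNorm ℤ) W K κ jbar)
      (X : (W.baseChange K).SelmerDualData κ γ),
      F.Dt = Dt ∧ Literature.NumberTheory.EllipticCurves.heegnerCharIdeal D F ^ 2 ≤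
        Literature.NumberTheory.EllipticCurves.Module.charIdeal
          (Literature.NumberTheory.EllipticCurves.IwasawaAlgebra p)
          (Submodule.torsion (Literature.NumberTheory.EllipticCurves.IwasawaAlgebra p) X.X) :=
  stub_muPart_divisibleClassNumber_of_muInvariant_le
    (fun W _ _ p _ _ K _ _ hX hns hcm hK hodd h3 hHN hHp hhK hirr κ hκ γ hγ Dt jbar hc hrk hfin D F X hFDt
        hfinS hfinX htors 𝔭 h𝔭 => by
      haveI := hfinS
      haveI := hfinX
      haveI : IsNoetherian (IwasawaAlgebra p) X.X := isNoetherian_of_isNoetherianRing_of_finite _ _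
      haveI : Module.Finite (IwasawaAlgebra p) (Submodule.torsion (IwasawaAlgebra p) X.X) := inferInstance
      haveI : Module.Finite (IwasawaAlgebra p) (D.S ⧸ heegnerModule D F) := inferInstance
      exact IwasawaAlgebra.lengthAt_le_two_mul_of_card_quotSMulTop_qm_le p _ _
        (Submodule.torsion_isTorsion (R := IwasawaAlgebra p) (M := X.X)) htors
        (hKS W p K hX hns hcm hK hodd h3 hHN hHp hhK hirr κ hκ γ hγ Dt jbar hc hrk hfin D F X hFDt hfinS hfinX
          htors) 𝔭 h𝔭)

end Summit.BirchSwinnertonDyer.BirchSwinnertonDyer.Cruxes.BeyondCarrierDepthX10b.HowardFrames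

end
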